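import Literature.IUT.HodgeArakelov.LabelClassesOfCuspsR2
import Literature.IUT.HodgeArakelov.LabelClassesOfCuspsNegative
import Mathlib.Topology.Constructions

/-!
# [IUTchII] Rmk 2.4.1 — the REPAIRED predicate `Rmk241_openOrTrivial'` holds at the model `ℤ_p` (proof file)

Proof-only companion (abc-iut-L6-t19) of the repair file `LabelClassesOfCuspsR2.lean`: the repaired
rendering `Rmk241_openOrTrivial'` of S. Mochizuki, *Inter-universal Teichmüller theory II* (kurims manuscript
Dec. 2020) Rmk. 2.4.1 p. 71 — "every closed subgroup of such a maximal pro-`l'` subgroup [≅ `ℤ_{l'}`] is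
either open or trivial" — is DISCHARGED at the intended model: for the (multiplicatively written) group
`ℤ_p`, every CLOSED subgroup is trivial or of finite index. Together with
`not_Rmk241_openOrTrivial_padicInt` (`LabelClassesOfCuspsNegative.lean`, p407862: the PRE-REPAIR predicate
is false at the same model) this records in the kernel that the repair is exactly the dropped hypothesis.
Claim key `Mochizuki2012`, status DISPUTED (D-0012): the statement discharged is a typing repair at a
classical model (`ℤ_p`), not a disputed claim; nothing here takes a side on [IUTchIII] Cor. 3.12.
-/

namespace Literature.IUT.HodgeArakelov

/-- **IUTchII:Rmk2.4.1′ at the model**: `Rmk241_openOrTrivial'` holds for `I' = ℤ_p` (written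
multiplicatively, `I' = ⊤`): a closed subgroup of `ℤ_p` is `⊥` or of finite index — from the additive
statement `closed_addSubgroup_padicInt_bot_or_finiteIndex` (closed ⇒ ideal by density of `ℤ`; nonzero
ideals are `p^n ℤ_p`). (The repaired predicate asks `K` closed in the ambient group; at this model the
ambient group IS `I'`, so this is the printed hypothesis.) [claim: Mochizuki2012, status: disputed]
(IUTchII §2 Rmk 2.4.1, kurims p.71) [cite: Mochizuki2012, Rmk 2.4.1 p.71] -/
theorem rmk241_openOrTrivial'_padicInt (p : ℕ) [Fact p.Prime] :
    Rmk241_openOrTrivial' (⊤ : Subgroup (Multiplicative ℤ_[p])) := by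
  intro K _ hK
  set A : AddSubgroup ℤ_[p] := Subgroup.toAddSubgroup' K with hAdef
  have hKA : AddSubgroup.toSubgroup A = K := AddSubgroup.toSubgroup.apply_symm_apply K
  have hA : IsClosed (A : Set ℤ_[p]) := hK
  rcases closed_addSubgroup_padicInt_bot_or_finiteIndex p A hA with h | h
  · left
    rw [← hKA, h]
    exact OrderIso.map_bot _
  · right
    have hKfin : K.FiniteIndex := by
      rw [Subgroup.finiteIndex_iff, ← hKA, AddSubgroup.index_toSubgroup]
      exact h.index_ne_zero
    infer_instance

end Literature.IUT.HodgeArakelov
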